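import Mathlib
import Literature.Topology.FourManifolds.RotationalQuotientFour
import Literature.Barriers.KontsevichZagierPeriods.HauptvermutungObstruction
import HarnessLib

/-!
# Lange: linear quotients `ℝⁿ/G` are PL manifolds iff `G` is a reflection–rotation group

Named facts (D-0014) for the cite item `wi-25746`, wanted by route SmoothPoincare4/LogCYSkeleton
(degenerate case of its informal crux `NonMax`, `stmt-SmoothPoincare4-13664`) and relevant to
route SmoothPoincare4/QuotientSpheres.

**Theorem (Lange 2016, main theorem, J. Topology 9 = arXiv:1509.06771, §1).** *For a finite
subgroup `G < O(n)` the quotient space `ℝⁿ/G` is a PL manifold with boundary if and only if `G`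
is a reflection–rotation group. In this case `ℝⁿ/G` is either PL homeomorphic to the half space
`ℝⁿ⁻¹ × ℝ_{≥0}` and `G` contains a reflection, or `ℝⁿ/G` is PL homeomorphic to `ℝⁿ` and `G` does
not contain a reflection.* Here a reflection (rotation) is an orthogonal transformation whose
fixed-point subspace has codimension one (two), a reflection–rotation group is a finite group
generated by reflections and rotations (loc. cit. §1, first paragraph), and `ℝⁿ/G` carries its
natural quotient PL structure (§3.2–3.3: `ℝⁿ/G = |K/G|` for an admissible triangulation `K` of
`ℝⁿ`, the unique PL space `Y` with a PL map `ℝⁿ → Y` inducing a homeomorphism `ℝⁿ/G ≅ Y`,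
Lemma 3.1).

## How the statement is typed (no abstract PL spaces are needed)

By the universal property of the PL quotient ([Lange2016, Lemma 3.1]) the quotient PL space
`ℝⁿ/G` is determined by any **PL orbit-space model**: a PL map `F : ℝⁿ → ℝᴺ` whose fibres are
exactly the `G`-orbits and which is a topological quotient map onto its image `Y = F(ℝⁿ)`; then
`Y ≅ ℝⁿ/G` and `ℝⁿ/G` is PL homeomorphic (as a PL space) to the polyhedron `Y`. Conversely the
natural quotient `|K/G| ⊂ ℝᴹ` is such a model. Hence:

* "`ℝⁿ/G` is PL homeomorphic to `ℝⁿ` (to a half space)" ⟺ there is a PL orbit-space model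
  `F : ℝⁿ → ℝⁿ` with image `ℝⁿ` (a closed coordinate half space) — `IsPLOrbitSpaceModel`;
* "`ℝⁿ/G` is a PL `n`-manifold with boundary" ⟺ some PL orbit-space model has image a PL
  `n`-manifold with boundary in the sense of [Lange2016, §3.1] (every point has a polyhedral
  neighbourhood PL homeomorphic to the standard simplex `Δⁿ`) — `IsPLManifoldWithBoundaryIn`.

PL maps are taken in the Euclidean sense of [Lange2016, §3.1] / Rourke–Sanderson; we REUSE the
tree's compact-polyhedron vocabulary `Literature.Barriers.KontsevichZagierPeriods.PL`
(`IsSimplex`, `IsPolyhedron` = finite union of simplices, `IsPLMapOn` = continuous and affine on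
the simplices of a finite cover, `PLHomeomorphic`) and call a map on all of `ℝⁿ` PL when it is PL
on every compact polyhedron (`IsPLMap`; PL-ness is local). Reflections/rotations reuse
`fixedSubspace` / `IsRotation` of `RotationalQuotientFour.lean`; `G < O(n)` is a finite subgroup
of linear automorphisms of `Fin n → ℝ` preserving the dot product (`IsOrthogonalSubgroup`).

The theorem is recorded as two named facts: the "if" direction with the two PL models
(`Lange2016_PLOrbitSpaceModel_of_reflectionRotation`, the paper's main contribution, §§5–6) and
the "only if" direction (`Lange2016_reflectionRotation_of_PLManifold`, §4).

Deliberately NOT here: the corollary the route draws for `S⁴/G` (it combines the main theorem in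
dimensions 4 and 5 with Armstrong's theorem and [Lange2016, Lemma 3.3]; not a printed statement),
Lemmas 5.3/5.6/5.7 (PL folklore: simply connected sphere quotients, union of balls, collapsible
PL manifolds are balls — they need the abstract-complex toolkit of definition request D1 of route
LogCYSkeleton), and the topological version [Lange2019] (whose only-if direction has the binary
icosahedral exception, loc. cit. §1).

## References

* C. Lange, *Characterization of finite groups generated by reflections and rotations*,
  J. Topology 9 (2016) 1109–1129 = arXiv:1509.06771: §1 (Theorem; reflection, rotation,
  reflection–rotation group), §3.1 (polyhedra, PL maps, PL manifolds with boundary, `Δⁿ`),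
  §3.2 Lemma 3.1 (PL quotients), §3.3 (admissible triangulations, `ℝⁿ/G = |K/G|`), §4 (only if),
  §§5–6 (if) — read in the held arXiv copy. [Lange2016]
* C. Lange, *When is the underlying space of an orbifold a manifold?*, Trans. AMS 372 (2019)
  2799–2828 (topological version). [Lange2019]
-/

noncomputable section

open Set Module
open _root_.Topology

namespace Literature.Topology.FourManifolds

/-! ### Reflections and reflection–rotation groups -/

section LinearAlgebra

variable {E : Type*} [AddCommGroup E] [Module ℝ E]

/-- **Reflection** (Lange 2016, §1): a linear transformation whose fixed-point subspace has
codimension one, `dim (E ⧸ Fix A) = 1` (for an orthogonal `A`: the reflection in the hyperplane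
`Fix A`). Companion of `IsRotation` (codimension two).
[cite: Lange2016, §1 Introduction (reflection: codimension one fixed point subspace)] -/
def IsReflection (A : E →ₗ[ℝ] E) : Prop :=
  finrank ℝ (E ⧸ fixedSubspace A) = 1

/-- Unfolding `IsReflection`. [folklore] -/
theorem isReflection_iff (A : E →ₗ[ℝ] E) :
    IsReflection A ↔ finrank ℝ (E ⧸ fixedSubspace A) = 1 :=
  Iff.rfl

/-- The identity is not a reflection. [folklore] -/
theorem not_isReflection_id : ¬ IsReflection (LinearMap.id : E →ₗ[ℝ] E) := by
  rw [isReflection_iff, fixedSubspace_id]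
  have h0 : finrank ℝ (E ⧸ (⊤ : Submodule ℝ E)) = 0 := finrank_zero_of_subsingleton
  omega

/-- A reflection is not a rotation (codimension one versus two). [folklore] -/
theorem IsReflection.not_isRotation {A : E →ₗ[ℝ] E} (h : IsReflection A) : ¬ IsRotation A := by
  rw [isRotation_iff]; rw [isReflection_iff] at h; omega

/-- **Reflection–rotation group** (Lange 2016, §1: "a finite group generated by reflections and
rotations … i.e. by orthogonal transformations with codimension one and two fixed point
subspaces"): a finite group `Γ` of linear automorphisms generated by the reflections and rotations
it contains. As for `IsRotationGroup`, `Γ < GL(E)` is allowed (the facts below add orthogonality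
explicitly). [cite: Lange2016, §1 Introduction (reflection-rotation group)] -/
def IsReflectionRotationGroup (Γ : Subgroup (E ≃ₗ[ℝ] E)) : Prop :=
  Finite Γ ∧ Subgroup.closure
    {g : E ≃ₗ[ℝ] E | g ∈ Γ ∧ (IsReflection (g : E →ₗ[ℝ] E) ∨ IsRotation (g : E →ₗ[ℝ] E))} = Γ

/-- Unfolding `IsReflectionRotationGroup`. [folklore] -/
theorem isReflectionRotationGroup_iff (Γ : Subgroup (E ≃ₗ[ℝ] E)) :
    IsReflectionRotationGroup Γ ↔ Finite Γ ∧ Subgroup.closure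
      {g : E ≃ₗ[ℝ] E | g ∈ Γ ∧ (IsReflection (g : E →ₗ[ℝ] E) ∨ IsRotation (g : E →ₗ[ℝ] E))} = Γ :=
  Iff.rfl

/-- A rotation group is a reflection–rotation group. [folklore] -/
theorem IsRotationGroup.isReflectionRotationGroup {Γ : Subgroup (E ≃ₗ[ℝ] E)}
    (h : IsRotationGroup Γ) : IsReflectionRotationGroup Γ := by
  refine ⟨h.1, le_antisymm ?_ ?_⟩
  · rw [Subgroup.closure_le]
    rintro g ⟨hg, -⟩
    exact hg
  · conv_lhs => rw [← h.2]
    exact Subgroup.closure_mono fun g hg => ⟨hg.1, Or.inr hg.2⟩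

/-- The trivial group is a reflection–rotation group. [folklore] -/
theorem isReflectionRotationGroup_bot : IsReflectionRotationGroup (⊥ : Subgroup (E ≃ₗ[ℝ] E)) :=
  isRotationGroup_bot.isReflectionRotationGroup

end LinearAlgebra

/-! ### Euclidean PL vocabulary for maps defined on all of `ℝⁿ` -/

section PL

variable {n N : ℕ}

/-- `Γ < O(n)`: every element of `Γ` preserves the dot product of `ℝⁿ = (Fin n → ℝ)`.
[folklore] -/
def IsOrthogonalSubgroup (Γ : Subgroup ((Fin n → ℝ) ≃ₗ[ℝ] (Fin n → ℝ))) : Prop :=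
  ∀ g ∈ Γ, ∀ x y : Fin n → ℝ, dotProduct (g x) (g y) = dotProduct x y

/-- A map `F : ℝⁿ → ℝᴺ` is **piecewise linear** if it is PL on every compact polyhedron of `ℝⁿ`
(continuous and affine on the simplices of a finite simplicial cover,
`Literature.Barriers.KontsevichZagierPeriods.PL.IsPLMapOn`); equivalently its graph is a
polyhedron ([Lange2016, §3.1]) — PL-ness is a local property. [cite: Lange2016, §3.1 (PL maps)] -/
def IsPLMap (F : (Fin n → ℝ) → (Fin N → ℝ)) : Prop :=
  ∀ P : Set (Fin n → ℝ), Literature.Barriers.KontsevichZagierPeriods.PL.IsPolyhedron P →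
    Literature.Barriers.KontsevichZagierPeriods.PL.IsPLMapOn P F

/-- **PL orbit-space model.** For a group `Γ` of linear automorphisms of `ℝⁿ`, a map
`F : ℝⁿ → ℝᴺ` is a PL model of the orbit space `ℝⁿ/Γ` if it is PL, its fibres are exactly the
`Γ`-orbits (`F x = F y ↔ y ∈ Γ·x`), and it is a topological quotient map onto its image — so that
the induced map `ℝⁿ/Γ → F(ℝⁿ)` is a homeomorphism and, by the universal property of PL
quotients, a PL homeomorphism from the quotient PL space `ℝⁿ/Γ = |K/Γ|` onto the polyhedron
`F(ℝⁿ)`. [cite: Lange2016, §3.2 Lemma 3.1 and §3.3 (the PL space ℝⁿ/G)] -/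
def IsPLOrbitSpaceModel (Γ : Subgroup ((Fin n → ℝ) ≃ₗ[ℝ] (Fin n → ℝ)))
    (F : (Fin n → ℝ) → (Fin N → ℝ)) : Prop :=
  IsPLMap F ∧ (∀ x y : Fin n → ℝ, F x = F y ↔ ∃ g ∈ Γ, g x = y) ∧
    IsQuotientMap (Set.rangeFactorization F)

/-- A subset `Y ⊆ ℝᴺ` is a **PL `n`-manifold with boundary** ([Lange2016, §3.1]: "for every point
`p ∈ X` there exists a chart `(P = Δⁿ, φ)` of `X` such that `p ∈ Int_X(φ(P))`"): every `y ∈ Y` has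
a neighbourhood `P ⊆ Y` (within `Y`) which is PL homeomorphic to the standard `n`-simplex
`Δⁿ = stdSimplex ℝ (Fin (n + 1))`. Boundary points are allowed (they correspond to `∂Δⁿ`).
[cite: Lange2016, §3.1 (PL manifold with boundary)] -/
def IsPLManifoldWithBoundaryIn (n : ℕ) (Y : Set (Fin N → ℝ)) : Prop :=
  ∀ y ∈ Y, ∃ P : Set (Fin N → ℝ), P ⊆ Y ∧ P ∈ 𝓝[Y] y ∧
    Literature.Barriers.KontsevichZagierPeriods.PL.PLHomeomorphic P (stdSimplex ℝ (Fin (n + 1)))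

/-- The closed coordinate half space `{x | 0 ≤ xᵢ} ⊂ ℝⁿ`, PL homeomorphic to
`ℝⁿ⁻¹ × ℝ_{≥0}`. [folklore] -/
def coordHalfSpace (i : Fin n) : Set (Fin n → ℝ) := {x | 0 ≤ x i}

/-- Membership in `coordHalfSpace`. [folklore] -/
@[simp] theorem mem_coordHalfSpace_iff (i : Fin n) (x : Fin n → ℝ) :
    x ∈ coordHalfSpace i ↔ 0 ≤ x i :=
  Iff.rfl

end PL

/-! ### The named facts -/

/-- **Lange 2016, main theorem — "if" direction with the PL models.** *If `G < O(n)` is a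
(finite) reflection–rotation group then `ℝⁿ/G` is PL homeomorphic to `ℝⁿ` when `G` contains no
reflection and to the half space `ℝⁿ⁻¹ × ℝ_{≥0}` when `G` contains a reflection.* Typed: there is
a PL orbit-space model `F : ℝⁿ → ℝⁿ` of `ℝⁿ/G` (`IsPLOrbitSpaceModel`) whose image is all of `ℝⁿ`,
resp. a closed coordinate half space. (E.g. `n = 1`, `G = {±1}`: `F x = |x|`; `n = 2`, `G = C_k`
rotations: the cone on the `k`-fold wrapped circle.) Grounds the cite item `wi-25746`
(route SmoothPoincare4/LogCYSkeleton). [cite: Lange2016, §1 Theorem (if direction) and §§5–6] -/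
def Lange2016_PLOrbitSpaceModel_of_reflectionRotation : Prop :=
  ∀ (n : ℕ) (Γ : Subgroup ((Fin n → ℝ) ≃ₗ[ℝ] (Fin n → ℝ))),
    IsOrthogonalSubgroup Γ → IsReflectionRotationGroup Γ →
      ∃ F : (Fin n → ℝ) → (Fin n → ℝ), IsPLOrbitSpaceModel Γ F ∧
        ((∀ g ∈ Γ, ¬ IsReflection (g : (Fin n → ℝ) →ₗ[ℝ] (Fin n → ℝ))) → Set.range F = Set.univ) ∧
        ((∃ g ∈ Γ, IsReflection (g : (Fin n → ℝ) →ₗ[ℝ] (Fin n → ℝ))) →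
          ∃ i : Fin n, Set.range F = coordHalfSpace i)

/-- **Lange 2016, main theorem — "only if" direction.** *If `G < O(n)` is finite and `ℝⁿ/G`
(with its quotient PL structure) is a PL manifold with boundary, then `G` is a reflection–rotation
group* (and `G` contains a reflection iff the boundary is non-empty, §4). Typed: if some PL
orbit-space model `F : ℝⁿ → ℝᴺ` of `ℝⁿ/G` has image a PL `n`-manifold with boundary
(`IsPLManifoldWithBoundaryIn`), then `G` is generated by the reflections and rotations it
contains. Grounds the cite item `wi-25746`. [cite: Lange2016, §1 Theorem (only-if direction) and §4] -/
def Lange2016_reflectionRotation_of_PLManifold : Prop :=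
  ∀ (n : ℕ) (Γ : Subgroup ((Fin n → ℝ) ≃ₗ[ℝ] (Fin n → ℝ))), Finite Γ → IsOrthogonalSubgroup Γ →
    (∃ (N : ℕ) (F : (Fin n → ℝ) → (Fin N → ℝ)),
        IsPLOrbitSpaceModel Γ F ∧ IsPLManifoldWithBoundaryIn n (Set.range F)) →
      IsReflectionRotationGroup Γ

/-! ### Sanity checks of the packaging (no mathematical content) -/

/-- The identity of `ℝⁿ` is a PL orbit-space model for the trivial group, PROVIDED it is PL —
which we take as a hypothesis here (triangulating a polyhedron into simplices is not in the tree);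
this only checks the orbit and quotient clauses. [folklore] -/
theorem isPLOrbitSpaceModel_bot_id {n : ℕ} (hPL : IsPLMap (id : (Fin n → ℝ) → (Fin n → ℝ))) :
    IsPLOrbitSpaceModel (⊥ : Subgroup ((Fin n → ℝ) ≃ₗ[ℝ] (Fin n → ℝ))) id := by
  refine ⟨hPL, fun x y => ?_, ?_⟩
  · constructor
    · intro h
      exact ⟨1, Subgroup.one_mem _, by simpa using h⟩
    · rintro ⟨g, hg, rfl⟩
      rw [Subgroup.mem_bot] at hg
      simp [hg]
  · let e : (Fin n → ℝ) ≃ₜ ↥(Set.range (id : (Fin n → ℝ) → (Fin n → ℝ))) :=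
      (Homeomorph.Set.univ (Fin n → ℝ)).symm.trans (Homeomorph.setCongr Set.range_id.symm)
    have : Set.rangeFactorization (id : (Fin n → ℝ) → (Fin n → ℝ)) = e := by
      funext x; ext; rfl
    rw [this]
    exact e.isQuotientMap

end Literature.Topology.FourManifolds

end
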